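import Summits.QuantumFields.BalabanUV.T4Continuum.Support.NE7CurvedAverageCurlLetter
import Summits.QuantumFields.BalabanUV.T4Continuum.Support.NE7CoarseCurlEnergyFlatSharp
import Mathlib.Algebra.Order.Chebyshev
import HarnessLib

/-!
# NE7CoarseCurlEnergyCurved — ONE LINEARISED AVERAGING STEP AT A SMALL-FIELD BACKGROUND DOES NOT INCREASE THE MAXWELL ENERGY BEYOND `(1+θ)·L^{4−d}`, UP TO
# `(1+θ⁻¹)·C·a²·(local mass)`: `Σ_P ‖curl_{V̄}(T_W ψ)(P)‖²_{HS∕n} ≤ (1+θ)(L⁴∕L^d)·Σ_p ‖curl_W ψ(p)‖²_{HS∕n} + (1+θ⁻¹)·energyErrC(d,L)·(curlLetterC(d,L)·a)²·‖ψ‖²_{ℓ²}`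
# (lineage `b2b-balaban-t4-ne7-p1`, gen 117, file F3; ROAD-G116 §7∕§9 (G1))

Cell `pub-balaban`, rung (B)+1 sub-cell t4, CRUX PROVER NE7 #1 (OWNER of row NE7), generation 117.  The CURVED twin of gen 116's ✓ `NE7CoarseCurlEnergyFlatSharp.coarse_curl_energy_le_sharp`
(flat background: constant `L^{4−d}`, no remainder).  Input: F2 ✓ `NE7CurvedAverageCurlLetter.norm_curlAt_cavg_cpush_sub_avgAd_le` (Bałaban's (48) at a small-field background with an
`O(a)·ℓ¹(box)` remainder); then Peter–Paul in the normalised Hilbert–Schmidt currency, Jensen (✓ `nhsNormSq_blockAvg_le`; the transports `Ad_{W(Γ)}` are HS isometries, ✓ `nhsNormSq_Ad`),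
the periodic covering identity (✓ `sum_stencil_periodBox`: every fine plaquette is counted `L²` times), Cauchy–Schwarz `ℓ¹(box)² ≤ #box·d·ℓ²(box)` and the box multiplicity on the torus
(✓ `sum_periodBox_box_le`).
WHAT ([folklore]; 0 sorry):
* `nhsNormSq_add_le_peterPaul` — `‖A + B‖²_{HS∕n} ≤ (1+θ)‖A‖² + (1+θ⁻¹)‖B‖²` (`θ > 0`).
* `dirL1_sq_le_card_mul_dirSq` — `dirL1 ψ B ² ≤ (#B·d)·dirSq ψ B`.
* `nhsNormSq_curlAt_cavg_cpush_le` — POINTWISE: `nhsNormSq(curlAt (cavg L W)(cpush L W ψ) z μ ν) ≤ (1+θ)(L²∕L^d)·Σ_{r,i,j} nhsNormSq(curlAt W ψ p μ ν) + (1+θ⁻¹)(curlLetterC·a)²·dirL1 ψ (box)²`.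
* **`coarse_curl_energy_le_curved`** — ON THE TORUS (`W`, `ψ` of period `L·M`):
  `Σ_{P∈perWin M} nhsNormSq(curl (cavg L W)(cpush L W ψ) P) ≤ (1+θ)(L⁴∕L^d)·Σ_{p∈perWin (L·M)} nhsNormSq(curl W ψ p) + (1+θ⁻¹)·energyErrC d L·(curlLetterC d L·a)²·dirSq ψ (periodBox (L·M))`,
  `energyErrC d L = #planes·(2R+1)^d·d·(2R+1)^d`, `R = (2d+4)L` — VOLUME-INDEPENDENT; in `d = 4` the main constant is `(1+θ)`.
HONEST FRAMING: lattice kinematics of ONE averaging step; the remainder is in the `ℓ²` mass of `ψ` AT THIS LEVEL (for the tower, the frame∕gauge part of the iterated field must be split off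
— see this generation's memo: the naive tower inequality with the scaled fine mass is FALSE on corner-charge gauge directions); nothing of Bałaban's asserted ((48) p. 25 context only);
NOT (G′), NOT NE7 as a spine node, NOT NE3; spine 0∕9; finite T⁴ rung (B)+1 — NOT infinite volume, NOT mass gap, NOT BetaPertH, NOT Clay.
-/

set_option autoImplicit false

open scoped BigOperators Matrix.Norms.L2Operator
open NormedSpace Finset

namespace Summit.QuantumFields.BalabanUV.T4Continuum.NE7CoarseCurlEnergyCurved

open Literature.MathematicalPhysics.QuantumFieldTheory.Balaban1983to89
open B7Prop1Explicit B7Prop2Explicit MatrixLog UnitaryModel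
open T4AveragingDeficitWall (IsUnitaryCfg SmallField Ad curl curlAt dirL1 dirSq box)
open T4AveragingDeficitWallBoundary (IsPeriodicCfg periodBox blockSites_periodBox)
open T4AveragingDeficitNonAbelian (sum_stencil_periodBox)
open AveragingDeficitPeriodicCounting (IsPeriodicDir curl_add_period sum_periodBox_box_le)
open AveragingDeficitCounting (card_box_eq)
open AveragingDeficitDerivCore (dirL1_nonneg)
open AveragingDeficitChartCalculus (cavg)
open AveragingDeficitMultiLevelPrep (cpush isPeriodicDir_cpush)
open AveragingDeficitFermat (isPeriodicCfg_cavg)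
open AveragingDeficitHSInner (nhsNormSq_smul nhsNormSq_add nhsNormSq_sub nhsNormSq_Ad hsRe hsRe_smul_left)
open AveragingDeficitPlaqLin (dirL1_eq_sum_prod)
open MatrixNorms (nhsNormSq nhsNormSq_nonneg nhsNormSq_le_opNorm_sq)
open MinimalActionLevels (perWin)
open NE7CoarseCurlEnergyFlatSharp (nhsNormSq_blockAvg_le)
open NE7CurvedAverageCurlLetter (curlLetterC curlLetterC_nonneg norm_curlAt_cavg_cpush_sub_avgAd_le)
open NE3EnergyHessContTwoTerm (dirSq_nonneg)

noncomputable section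

variable {d : ℕ} {n : Type*} [Fintype n] [DecidableEq n]

/-! ## §1 Peter–Paul in the normalised Hilbert–Schmidt currency; `ℓ¹(box)² ≤ #·ℓ²(box)` -/

omit [DecidableEq n] in
/-- **Peter–Paul**: `‖A + B‖²_{HS∕n} ≤ (1+θ)·‖A‖²_{HS∕n} + (1+θ⁻¹)·‖B‖²_{HS∕n}` for `θ > 0`. [folklore] -/
theorem nhsNormSq_add_le_peterPaul (A B : Matrix n n ℂ) {θ : ℝ} (hθ : 0 < θ) :
    nhsNormSq (A + B) ≤ (1 + θ) * nhsNormSq A + (1 + θ⁻¹) * nhsNormSq B := by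
  have h0 : 0 ≤ nhsNormSq (θ • A - B) := nhsNormSq_nonneg _
  rw [nhsNormSq_sub, nhsNormSq_smul, hsRe_smul_left] at h0
  rw [nhsNormSq_add]
  have hA := nhsNormSq_nonneg A
  have hB := nhsNormSq_nonneg B
  -- `2·hsRe A B ≤ θ‖A‖² + θ⁻¹‖B‖²`
  have hkey : 2 * hsRe A B ≤ θ * nhsNormSq A + θ⁻¹ * nhsNormSq B := by
    have hθinv : θ⁻¹ * θ = 1 := inv_mul_cancel₀ hθ.ne'
    have e1 : θ⁻¹ * θ ^ 2 = θ := by rw [pow_two, ← mul_assoc, hθinv, one_mul]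
    have e2 : θ⁻¹ * (2 * (θ * hsRe A B)) = 2 * hsRe A B := by
      calc θ⁻¹ * (2 * (θ * hsRe A B)) = 2 * ((θ⁻¹ * θ) * hsRe A B) := by ring
        _ = 2 * hsRe A B := by rw [hθinv, one_mul]
    have e3 : θ⁻¹ * (θ ^ 2 * nhsNormSq A + nhsNormSq B - 2 * (θ * hsRe A B)) = θ * nhsNormSq A + θ⁻¹ * nhsNormSq B - 2 * hsRe A B := by
      calc θ⁻¹ * (θ ^ 2 * nhsNormSq A + nhsNormSq B - 2 * (θ * hsRe A B))
          = θ⁻¹ * θ ^ 2 * nhsNormSq A + θ⁻¹ * nhsNormSq B - θ⁻¹ * (2 * (θ * hsRe A B)) := by ring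
        _ = _ := by rw [e1, e2]
    have h3 : 0 ≤ θ⁻¹ * (θ ^ 2 * nhsNormSq A + nhsNormSq B - 2 * (θ * hsRe A B)) := mul_nonneg (inv_nonneg.mpr hθ.le) h0
    rw [e3] at h3
    linarith
  nlinarith

/-- **Cauchy–Schwarz**: `dirL1 ψ B ² ≤ (#B · d) · dirSq ψ B`. [folklore] -/
theorem dirL1_sq_le_card_mul_dirSq (ψ : Site d → Fin d → Matrix n n ℂ) (B : Finset (Site d)) :
    dirL1 ψ B ^ 2 ≤ ((B.card * d : ℕ) : ℝ) * dirSq ψ B := by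
  have h1 : dirSq ψ B = ∑ b ∈ B ×ˢ (Finset.univ : Finset (Fin d)), ‖ψ b.1 b.2‖ ^ 2 := by
    unfold T4AveragingDeficitWall.dirSq; rw [Finset.sum_product]
  rw [dirL1_eq_sum_prod, h1]
  have h := sq_sum_le_card_mul_sum_sq (s := B ×ˢ (Finset.univ : Finset (Fin d))) (f := fun b => ‖ψ b.1 b.2‖)
  rw [Finset.card_product, Finset.card_univ, Fintype.card_fin] at h
  exact h

/-! ## §2 Pointwise: one coarse plaquette -/

/-- **POINTWISE**: for `U(N)` data `W` in the standard small-field class, every `ψ`, every coarse plaquette `(z; μ, ν)` and every `θ > 0`,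
`nhsNormSq(curlAt (cavg L W)(cpush L W ψ) z μ ν) ≤ (1+θ)(L²∕L^d)·Σ_{r,i,j} nhsNormSq(curlAt W ψ (L•z + x_r + i e_μ + j e_ν) μ ν) + (1+θ⁻¹)·(curlLetterC d L·a·dirL1 ψ (box ((2d+4)L) (L•z)))²`.
[cite: Balaban1985Averaging, (48) p.25] -/
theorem nhsNormSq_curlAt_cavg_cpush_le [Nonempty n] {L : ℕ} [NeZero L] (hL : 1 ≤ L) {W : Site d → Fin d → (Matrix n n ℂ)ˣ} (hW : IsUnitaryCfg W)
    {a : ℝ} (ha : 0 ≤ a) (h512 : 512 * (d + 1) * (d + 4) * (L : ℝ) ^ 2 * a ≤ 1) (hWa : SmallField W a)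
    (ψ : Site d → Fin d → Matrix n n ℂ) (z : Site d) (μ ν : Fin d) {θ : ℝ} (hθ : 0 < θ) :
    nhsNormSq (curlAt (cavg L W) (cpush L W ψ) z μ ν)
      ≤ (1 + θ) * ((L : ℝ) ^ 2 / (L : ℝ) ^ d * ∑ r : Fin d → Fin L, ∑ i ∈ Finset.range L, ∑ j ∈ Finset.range L,
            nhsNormSq (curlAt W ψ ((L : ℤ) • z + boxVec L r + (i : ℤ) • e μ + (j : ℤ) • e ν) μ ν))
        + (1 + θ⁻¹) * (curlLetterC d L * a * dirL1 ψ (box ((2 * d + 4) * L) ((L : ℤ) • z))) ^ 2 := by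
  set main : Matrix n n ℂ := ∑ r : Fin d → Fin L, (((L : ℝ) ^ d)⁻¹ : ℝ) • ∑ i ∈ Finset.range L, ∑ j ∈ Finset.range L,
      Ad (hol W ((L : ℤ) • z) (treeWord (boxVec L r + (i : ℤ) • e μ + (j : ℤ) • e ν)))
        (curlAt W ψ ((L : ℤ) • z + boxVec L r + (i : ℤ) • e μ + (j : ℤ) • e ν) μ ν) with hmain
  set X := curlAt (cavg L W) (cpush L W ψ) z μ ν with hX
  have hE := norm_curlAt_cavg_cpush_sub_avgAd_le hL hW ha h512 hWa ψ z μ ν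
  rw [← hmain, ← hX] at hE
  have hsplit : X = main + (X - main) := by abel
  rw [hsplit]
  refine (nhsNormSq_add_le_peterPaul main (X - main) hθ).trans (add_le_add ?_ ?_)
  · refine mul_le_mul_of_nonneg_left ?_ (by linarith)
    rw [hmain]
    refine (nhsNormSq_blockAvg_le L _).trans (le_of_eq ?_)
    congr 1
    refine Finset.sum_congr rfl fun r _ => Finset.sum_congr rfl fun i _ => Finset.sum_congr rfl fun j _ => ?_
    exact nhsNormSq_Ad (hol_mem_of hW _ _) _
  · refine mul_le_mul_of_nonneg_left ?_ (by positivity)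
    refine (nhsNormSq_le_opNorm_sq _).trans ?_
    have h0 : 0 ≤ ‖X - main‖ := norm_nonneg _
    exact pow_le_pow_left₀ h0 hE 2

/-! ## §3 On the torus: the one-step energy inequality -/

/-- THE VOLUME-INDEPENDENT MULTIPLICITY CONSTANT of the remainder: `#planes · ((2R+1)^d · d) · (2R+1)^d`, `R = (2d+4)L`. [folklore] -/
def energyErrC (d L : ℕ) : ℝ :=
  (Fintype.card (T4AveragingDeficitWall.Plane d) : ℝ) * ((((2 * ((2 * d + 4) * L) + 1) ^ d * d : ℕ) : ℝ) * (((2 * ((2 * d + 4) * L) + 1) ^ d : ℕ) : ℝ))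

omit [Fintype n] [DecidableEq n] in
/-- `0 ≤ energyErrC d L`. [folklore] -/
theorem energyErrC_nonneg (d L : ℕ) : 0 ≤ energyErrC d L := by unfold energyErrC; positivity

/-- **ONE LINEARISED AVERAGING STEP AT A SMALL-FIELD BACKGROUND** (`W` unitary of period `L·M` in the standard small-field class, `ψ` of period `L·M`, `θ > 0`):
`Σ_{P∈perWin M} nhsNormSq(curl (cavg L W)(cpush L W ψ) P) ≤ (1+θ)(L⁴∕L^d)·Σ_{p∈perWin (L·M)} nhsNormSq(curl W ψ p) + (1+θ⁻¹)·energyErrC d L·(curlLetterC d L·a)²·dirSq ψ (periodBox (L·M))`.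
The flat case (`a = 0`, `θ → 0`) is gen 116's sharp `L^{4−d}`. [cite: Balaban1985Averaging, (48) p.25] -/
theorem coarse_curl_energy_le_curved [Nonempty n] {L M : ℕ} [NeZero L] (hL : 1 ≤ L) (hM : 1 ≤ M) {W : Site d → Fin d → (Matrix n n ℂ)ˣ}
    (hW : IsUnitaryCfg W) (hWP : IsPeriodicCfg W ((L : ℤ) * M))
    {a : ℝ} (ha : 0 ≤ a) (h512 : 512 * (d + 1) * (d + 4) * (L : ℝ) ^ 2 * a ≤ 1) (hWa : SmallField W a)
    {ψ : Site d → Fin d → Matrix n n ℂ} (hψP : IsPeriodicDir ψ ((L : ℤ) * M)) {θ : ℝ} (hθ : 0 < θ) :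
    ∑ P ∈ perWin d M, nhsNormSq (curl (cavg L W) (cpush L W ψ) P)
      ≤ (1 + θ) * ((L : ℝ) ^ 4 / (L : ℝ) ^ d) * ∑ p ∈ perWin d (L * M), nhsNormSq (curl W ψ p)
        + (1 + θ⁻¹) * energyErrC d L * (curlLetterC d L * a) ^ 2 * dirSq ψ (periodBox (L * M)) := by
  classical
  have hL0 : (L : ℝ) ≠ 0 := by exact_mod_cast (NeZero.ne L)
  set R : ℕ := (2 * d + 4) * L with hR
  set K : ℝ := curlLetterC d L * a with hK
  have hK0 : 0 ≤ K := mul_nonneg (curlLetterC_nonneg d L) ha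
  have hθ1 : 0 ≤ 1 + θ := by linarith
  have hθ2 : 0 ≤ 1 + θ⁻¹ := by positivity
  have hLM : (((L * M : ℕ) : ℤ)) = (L : ℤ) * M := by push_cast; ring
  -- periodicity of the fine integrands
  have hcurlP : ∀ (π : T4AveragingDeficitWall.Plane d) (x : Site d) (κ : Fin d),
      nhsNormSq (curl W ψ (x + ((L * M : ℕ) : ℤ) • e κ, π)) = nhsNormSq (curl W ψ (x, π)) := by
    intro π x κ; rw [hLM, curl_add_period hWP hψP x κ π]
  have hmassP : ∀ (x : Site d) (κ : Fin d), (∑ μ : Fin d, ‖ψ (x + ((L * M : ℕ) : ℤ) • e κ) μ‖ ^ 2) = ∑ μ : Fin d, ‖ψ x μ‖ ^ 2 := by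
    intro x κ; rw [hLM]; exact Finset.sum_congr rfl fun μ _ => by rw [hψP x κ μ]
  -- pointwise
  have hpt : ∀ (z : Site d) (π : T4AveragingDeficitWall.Plane d),
      nhsNormSq (curl (cavg L W) (cpush L W ψ) (z, π))
        ≤ (1 + θ) * ((L : ℝ) ^ 2 / (L : ℝ) ^ d * ∑ r : Fin d → Fin L, ∑ i ∈ Finset.range L, ∑ j ∈ Finset.range L,
              nhsNormSq (curl W ψ ((L : ℤ) • z + boxVec L r + (i : ℤ) • e π.1.1 + (j : ℤ) • e π.1.2, π)))
          + (1 + θ⁻¹) * (K ^ 2 * ((((2 * R + 1) ^ d * d : ℕ) : ℝ) * dirSq ψ (box R ((L : ℤ) • z)))) := by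
    intro z π
    have h := nhsNormSq_curlAt_cavg_cpush_le hL hW ha h512 hWa ψ z π.1.1 π.1.2 hθ
    refine h.trans (add_le_add le_rfl (mul_le_mul_of_nonneg_left ?_ hθ2))
    rw [mul_pow, ← hK, ← hR]
    refine mul_le_mul_of_nonneg_left ?_ (sq_nonneg K)
    have hcs := dirL1_sq_le_card_mul_dirSq ψ (box R ((L : ℤ) • z))
    rwa [card_box_eq] at hcs
  -- sum over the coarse period window
  rw [perWin, Finset.sum_product, perWin, Finset.sum_product]
  have hmain : ∀ π : T4AveragingDeficitWall.Plane d,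
      ∑ z ∈ periodBox M, ∑ r : Fin d → Fin L, ∑ i ∈ Finset.range L, ∑ j ∈ Finset.range L,
          nhsNormSq (curl W ψ ((L : ℤ) • z + boxVec L r + (i : ℤ) • e π.1.1 + (j : ℤ) • e π.1.2, π))
        = (L : ℝ) ^ 2 * ∑ x ∈ periodBox (L * M), nhsNormSq (curl W ψ (x, π)) := by
    intro π
    rw [sum_stencil_periodBox L M hL hM (g := fun x => nhsNormSq (curl W ψ (x, π))) (fun x κ => hcurlP π x κ) π.1.1 π.1.2,
      blockSites_periodBox L M hL]
  have herr : ∑ z ∈ periodBox M, dirSq ψ (box R ((L : ℤ) • z)) ≤ (((2 * R + 1) ^ d : ℕ) : ℝ) * dirSq ψ (periodBox (L * M)) := by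
    have h := sum_periodBox_box_le L M hL hM R (g := fun x => ∑ μ : Fin d, ‖ψ x μ‖ ^ 2) (fun x => Finset.sum_nonneg fun _ _ => sq_nonneg _) hmassP
    unfold T4AveragingDeficitWall.dirSq
    exact_mod_cast h
  calc ∑ z ∈ periodBox M, ∑ π : T4AveragingDeficitWall.Plane d, nhsNormSq (curl (cavg L W) (cpush L W ψ) (z, π))
      ≤ ∑ z ∈ periodBox M, ∑ π : T4AveragingDeficitWall.Plane d,
          ((1 + θ) * ((L : ℝ) ^ 2 / (L : ℝ) ^ d * ∑ r : Fin d → Fin L, ∑ i ∈ Finset.range L, ∑ j ∈ Finset.range L,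
              nhsNormSq (curl W ψ ((L : ℤ) • z + boxVec L r + (i : ℤ) • e π.1.1 + (j : ℤ) • e π.1.2, π)))
            + (1 + θ⁻¹) * (K ^ 2 * ((((2 * R + 1) ^ d * d : ℕ) : ℝ) * dirSq ψ (box R ((L : ℤ) • z))))) :=
        Finset.sum_le_sum fun z _ => Finset.sum_le_sum fun π _ => hpt z π
    _ = (1 + θ) * ((L : ℝ) ^ 2 / (L : ℝ) ^ d) * ∑ π : T4AveragingDeficitWall.Plane d, ∑ z ∈ periodBox M,
            ∑ r : Fin d → Fin L, ∑ i ∈ Finset.range L, ∑ j ∈ Finset.range L,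
              nhsNormSq (curl W ψ ((L : ℤ) • z + boxVec L r + (i : ℤ) • e π.1.1 + (j : ℤ) • e π.1.2, π))
          + (1 + θ⁻¹) * (K ^ 2 * ((((2 * R + 1) ^ d * d : ℕ) : ℝ) *
              ((Fintype.card (T4AveragingDeficitWall.Plane d) : ℝ) * ∑ z ∈ periodBox M, dirSq ψ (box R ((L : ℤ) • z))))) := by
        rw [Finset.sum_comm]
        simp only [Finset.sum_add_distrib, Finset.sum_const, Finset.card_univ, nsmul_eq_mul, ← Finset.mul_sum]
        rw [Finset.sum_comm]
        ring
    _ = (1 + θ) * ((L : ℝ) ^ 4 / (L : ℝ) ^ d) * ∑ x ∈ periodBox (L * M), ∑ π : T4AveragingDeficitWall.Plane d, nhsNormSq (curl W ψ (x, π))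
          + (1 + θ⁻¹) * (K ^ 2 * ((((2 * R + 1) ^ d * d : ℕ) : ℝ) *
              ((Fintype.card (T4AveragingDeficitWall.Plane d) : ℝ) * ∑ z ∈ periodBox M, dirSq ψ (box R ((L : ℤ) • z))))) := by
        congr 1
        simp only [hmain, ← Finset.mul_sum]
        rw [Finset.sum_comm]
        field_simp
    _ ≤ (1 + θ) * ((L : ℝ) ^ 4 / (L : ℝ) ^ d) * ∑ x ∈ periodBox (L * M), ∑ π : T4AveragingDeficitWall.Plane d, nhsNormSq (curl W ψ (x, π))
          + (1 + θ⁻¹) * (K ^ 2 * ((((2 * R + 1) ^ d * d : ℕ) : ℝ) *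
              ((Fintype.card (T4AveragingDeficitWall.Plane d) : ℝ) * ((((2 * R + 1) ^ d : ℕ) : ℝ) * dirSq ψ (periodBox (L * M)))))) := by
        have := mul_le_mul_of_nonneg_left herr (Nat.cast_nonneg (Fintype.card (T4AveragingDeficitWall.Plane d)))
        have h2 : 0 ≤ (1 + θ⁻¹) * (K ^ 2 * ((((2 * R + 1) ^ d * d : ℕ) : ℝ))) := by positivity
        nlinarith
    _ = _ := by simp only [energyErrC, ← hR]; ring

end

end Summit.QuantumFields.BalabanUV.T4Continuum.NE7CoarseCurlEnergyCurved
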